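import Summits.CriticalPhenomena.PercolationContinuityZ3.Theorems.PercNearOneGluingNoHeavyLowerTailWorstPairExchangeCex

/-!
# `NoHeavyLowerTail` (stmt-CriticalPhenomena-4575): the JOINT glued transfer is FALSE — a kernel-checked
# five-vertex counterexample (engine no-go, ENGINE-g2.md §5b; ttrl2 census `run/shared/lean/ttrl/llc/JGT.md`)

The single-port glued transfer `LossyPocketT.blockSmall_le_gluedSmall_add` (Kozma–Nitzan's Lemma 5 with the
additive slack of their Lemma 3(ii); file `…LossyPocketTransfer.lean`) reads: for a block `N ∋ v` and a vertex
`c`, if `μ{|π(v)| ≤ j} ≤ μ{|π(c)| ≤ j} + δ` then `μ{block N j-small} ≤ μ{c j-small in G + K_N} + δ`.  The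
compute census of the crux showed that slack to be hopeless at glued groups, and suggested the JOINT version
(JGT): replace the hypothesis by `μ{∀ v ∈ N, |π(v)| ≤ j} ≤ μ{|π(c)| ≤ j} + δ`.  **(JGT) is false**:

* `JointTransferCex.wit` — five relays `A = Fin 5`, `c = 0`, ports `N = {1, 2}`, level `j = 2`, weights
  `w(0,1) = 1/2`, `w(0,3) = 1/2`, `w(3,4) = 1`, `w(2,3) = 1/4` (the pair `{3,4}` is a glued reservoir shared by
  `c` and the port `2`; the port `1` hangs on `c` only).
* exact values (`arith`, kernel `decide`, `2⁴` configurations): `μ{block small} = 3/8`,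
  `μ{c small in G + K_N} = 1/4`, `μ{both ports small} = 9/16`, `μ{c small} = 1/2`; so the joint hypothesis holds
  with `δ = 1/16` while the conclusion would need `3/8 ≤ 1/4 + 1/16 = 5/16`.
* `jointTransfer_cex` (the instance) and `not_jointGluedTransfer` (the negation of the universally quantified
  statement in the exact shape of `LossyPocketT.blockSmall_le_gluedSmall_add` with the joint hypothesis).

Mechanism (the identity behind it): with `T = {c ↔ N}`, `μ(B) − μ(CSM) = μ(B) − μ(S) + μ(S ∩ T ∩ Bᶜ)`; the last
term — `c` hangs on a SMALL port while another port sits in a big cluster — is what the joint slack does not pay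
(`LossyPocketT.blockSmall_le_gluedSmall_add_rho` keeps it as `ρ_c`).  The checker half reuses the weighted
certificate machinery (`WorstPairExchangeCex.real_eq_wcount`: probability = exact weighted count of a `Bool` test on
reach tables); arithmetic by kernel `decide`, standard axioms, no `native_decide`, no sorries; the `def`s are the
witness data and computable checkers only.
-/

namespace Summit.CriticalPhenomena.PercolationContinuityZ3.Theorems

open MeasureTheory
open Literature.Probability.LatticeModels Literature.Probability.Percolation
open Summit.CriticalPhenomena.PercolationContinuityZ3.Theorems.AdditiveGluing.Negative.Cert
open WorstPairExchangeCex (real_eq_wcount)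

namespace JointTransferCex

/-! ### Witness data -/

/-- The witness: `w(0,1) = 1/2`, `w(0,3) = 1/2`, `w(3,4) = 1`, `w(2,3) = 1/4` on `Fin 5`. -/
def wit : List (Fin 5 × Fin 5 × ℚ) := [(0, 1, 1/2), (0, 3, 1/2), (3, 4, 1), (2, 3, 1/4)]

/-- The witness is a weighted edge list: distinct pairs, weights in `[0, 1]`. [this file] -/
theorem wit_ok : (wPairs wit).Nodup ∧ ∀ e ∈ wit, 0 ≤ e.2.2 ∧ e.2.2 ≤ 1 := by
  refine ⟨by decide, fun e he => ?_⟩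
  simp only [wit, List.mem_cons, List.not_mem_nil, or_false] at he
  rcases he with rfl | rfl | rfl | rfl <;> norm_num

/-! ### The four events as `Bool` tests on reach tables -/

/-- Number of relays (all five vertices) reachable from `x`. -/
def cntC (tb : List ℕ) (x : Fin 5) : ℕ :=
  ((Finset.univ : Finset (Fin 5)).filter fun z : Fin 5 => (tb.getD x.val 0).testBit z.val = true).card

/-- Number of relays reachable from the block `N = {1, 2}`. -/
def cntBlk (tb : List ℕ) : ℕ :=
  ((Finset.univ : Finset (Fin 5)).filter fun z : Fin 5 =>
    ∃ a ∈ ({1, 2} : Finset (Fin 5)), (tb.getD a.val 0).testBit z.val = true).card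

/-- The block `N = {1,2}` is `2`-small. -/
def blkB (tb : List ℕ) : Bool := decide (cntBlk tb ≤ 2)

/-- `c = 0` is `2`-small. -/
def smallB (tb : List ℕ) : Bool := decide (cntC tb 0 ≤ 2)

/-- Both ports are `2`-small. -/
def jointB (tb : List ℕ) : Bool := decide (∀ v ∈ ({1, 2} : Finset (Fin 5)), cntC tb v ≤ 2)

/-- `c = 0` is `2`-small in the graph with `N` glued. -/
def csmB (tb : List ℕ) : Bool :=
  decide (((∃ a ∈ ({1, 2} : Finset (Fin 5)), (tb.getD (0 : Fin 5).val 0).testBit a.val = true) ∧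
      cntBlk tb ≤ 2) ∨
    ((¬ ∃ a ∈ ({1, 2} : Finset (Fin 5)), (tb.getD (0 : Fin 5).val 0).testBit a.val = true) ∧ cntC tb 0 ≤ 2))

/-- Exact weighted count of a `Bool` test over the `2⁴` configurations of the witness. -/
def cnt (f : List ℕ → Bool) : ℚ := ((wtabs 5 wit).map fun t => if f t.1 then t.2 else 0).sum

/-- The arithmetic: `μ{block small} = 3/8`, `μ{c small in G+K_N} = 1/4`, `μ{both ports small} = 9/16`,
`μ{c small} = 1/2` (kernel `decide`). [this file] -/
theorem arith : cnt blkB = 3 / 8 ∧ cnt csmB = 1 / 4 ∧ cnt jointB = 9 / 16 ∧ cnt smallB = 1 / 2 := by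
  decide +kernel

open scoped Classical

/-- Per-configuration agreement of the relay count of a vertex. [this file] -/
theorem cntC_reachTable (ω : List (Fin 5 × Fin 5)) (x : Fin 5) :
    cntC (reachTable 5 ω) x =
      ((Finset.univ : Finset (Fin 5)).filter fun z =>
        (↑(Eset ω) : Set (Sym2 (Fin 5))) ∈ openConn x z).card := by
  unfold cntC
  rw [Finset.filter_congr fun z _ => testBit_reachTable_iff_mem_openConn ω x z]

/-- Per-configuration agreement of the relay count of the block. [this file] -/
theorem cntBlk_reachTable (ω : List (Fin 5 × Fin 5)) :
    cntBlk (reachTable 5 ω) =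
      ((Finset.univ : Finset (Fin 5)).filter fun z =>
        ∃ a ∈ ({1, 2} : Finset (Fin 5)), (↑(Eset ω) : Set (Sym2 (Fin 5))) ∈ openConn a z).card := by
  unfold cntBlk
  rw [Finset.filter_congr fun z _ =>
    exists_congr fun a => and_congr_right fun _ => testBit_reachTable_iff_mem_openConn ω a z]

/-- `μ{block small} = cnt blkB`. [this file] -/
theorem real_blk :
    (prodBernoulli (wOfList wit)).real {ω : BondConfig (Fin 5) |
        ((Finset.univ : Finset (Fin 5)).filter fun y =>
          ∃ a ∈ ({1, 2} : Finset (Fin 5)), ω ∈ openConn a y).card ≤ 2} = (cnt blkB : ℝ) := by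
  refine real_eq_wcount wit_ok.1 wit_ok.2 blkB _ fun ω => ?_
  simp only [blkB, decide_eq_true_eq, Set.mem_setOf_eq, cntBlk_reachTable]

/-- `μ{c small} = cnt smallB`. [this file] -/
theorem real_small :
    (prodBernoulli (wOfList wit)).real {ω : BondConfig (Fin 5) |
        ((Finset.univ : Finset (Fin 5)).filter fun y => ω ∈ openConn (0 : Fin 5) y).card ≤ 2} =
      (cnt smallB : ℝ) := by
  refine real_eq_wcount wit_ok.1 wit_ok.2 smallB _ fun ω => ?_
  simp only [smallB, decide_eq_true_eq, Set.mem_setOf_eq, cntC_reachTable]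

/-- `μ{both ports small} = cnt jointB`. [this file] -/
theorem real_joint :
    (prodBernoulli (wOfList wit)).real {ω : BondConfig (Fin 5) |
        ∀ v ∈ ({1, 2} : Finset (Fin 5)),
          ((Finset.univ : Finset (Fin 5)).filter fun y => ω ∈ openConn v y).card ≤ 2} = (cnt jointB : ℝ) := by
  refine real_eq_wcount wit_ok.1 wit_ok.2 jointB _ fun ω => ?_
  simp only [jointB, decide_eq_true_eq, Set.mem_setOf_eq, cntC_reachTable]

/-- `μ{c small in G + K_N} = cnt csmB`. [this file] -/
theorem real_csm :
    (prodBernoulli (wOfList wit)).real {ω : BondConfig (Fin 5) |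
        ((∃ a ∈ ({1, 2} : Finset (Fin 5)), ω ∈ openConn (0 : Fin 5) a) ∧
            ((Finset.univ : Finset (Fin 5)).filter fun y =>
              ∃ a ∈ ({1, 2} : Finset (Fin 5)), ω ∈ openConn a y).card ≤ 2) ∨
          ((¬ ∃ a ∈ ({1, 2} : Finset (Fin 5)), ω ∈ openConn (0 : Fin 5) a) ∧
            ((Finset.univ : Finset (Fin 5)).filter fun y => ω ∈ openConn (0 : Fin 5) y).card ≤ 2)} =
      (cnt csmB : ℝ) := by
  refine real_eq_wcount wit_ok.1 wit_ok.2 csmB _ fun ω => ?_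
  simp only [csmB, decide_eq_true_eq, Set.mem_setOf_eq, cntC_reachTable, cntBlk_reachTable,
    testBit_reachTable_iff_mem_openConn]

end JointTransferCex

open JointTransferCex
open scoped Classical

/-- **The instance.**  For the witness weights on `Fin 5`, `A = Fin 5`, ports `N = {1,2}`, `c = 0`, `j = 2`:
`μ{block small} = 3/8 > 5/16 = μ{c small in G + K_N} + (μ{both ports small} − μ{c small})⁺`.
[this work; ttrl2 `run/shared/lean/ttrl/llc/JGT.md`] -/
theorem jointTransfer_cex :
    (prodBernoulli (wOfList wit)).real {ω : BondConfig (Fin 5) |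
        ((Finset.univ : Finset (Fin 5)).filter fun y =>
          ∃ a ∈ ({1, 2} : Finset (Fin 5)), ω ∈ openConn a y).card ≤ 2} >
      (prodBernoulli (wOfList wit)).real {ω : BondConfig (Fin 5) |
          ((∃ a ∈ ({1, 2} : Finset (Fin 5)), ω ∈ openConn (0 : Fin 5) a) ∧
              ((Finset.univ : Finset (Fin 5)).filter fun y =>
                ∃ a ∈ ({1, 2} : Finset (Fin 5)), ω ∈ openConn a y).card ≤ 2) ∨
            ((¬ ∃ a ∈ ({1, 2} : Finset (Fin 5)), ω ∈ openConn (0 : Fin 5) a) ∧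
              ((Finset.univ : Finset (Fin 5)).filter fun y => ω ∈ openConn (0 : Fin 5) y).card ≤ 2)} +
        max ((prodBernoulli (wOfList wit)).real {ω : BondConfig (Fin 5) |
              ∀ v ∈ ({1, 2} : Finset (Fin 5)),
                ((Finset.univ : Finset (Fin 5)).filter fun y => ω ∈ openConn v y).card ≤ 2} -
            (prodBernoulli (wOfList wit)).real {ω : BondConfig (Fin 5) |
              ((Finset.univ : Finset (Fin 5)).filter fun y => ω ∈ openConn (0 : Fin 5) y).card ≤ 2}) 0 := by
  rw [real_blk, real_csm, real_joint, real_small, arith.1, arith.2.1, arith.2.2.1, arith.2.2.2]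
  norm_num

/-- **No-go: the joint glued transfer (JGT) is false.**  It is NOT true that for all weights, relay sets `A`,
blocks `N`, vertices `c ∉ N`, levels `j` and slacks `δ ≥ 0`,
`μ{∀ v ∈ N, |π(v)| ≤ j} ≤ μ{|π(c)| ≤ j} + δ` implies `μ{block N j-small} ≤ μ{c j-small in G + K_N} + δ`
(the single-port version, with `∀ v ∈ N` replaced by one `v ∈ N`, is the theorem
`LossyPocketT.blockSmall_le_gluedSmall_add`).  Witness: `jointTransfer_cex` with `δ = 1/16`.
[this work; ttrl2 `run/shared/lean/ttrl/llc/JGT.md`] -/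
theorem not_jointGluedTransfer :
    ¬ ∀ (n : ℕ) (w : Sym2 (Fin n) → unitInterval) (A N : Finset (Fin n)) (c : Fin n) (j : ℕ) (δ : ℝ),
      0 ≤ δ → c ∉ N →
      (prodBernoulli w).real {ω : BondConfig (Fin n) |
          ∀ v ∈ N, (A.filter fun y => ω ∈ openConn v y).card ≤ j} ≤
        (prodBernoulli w).real {ω : BondConfig (Fin n) | (A.filter fun y => ω ∈ openConn c y).card ≤ j} + δ →
      (prodBernoulli w).real {ω : BondConfig (Fin n) |
          (A.filter fun y => ∃ a ∈ N, ω ∈ openConn a y).card ≤ j} ≤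
        (prodBernoulli w).real {ω : BondConfig (Fin n) |
          ((∃ a ∈ N, ω ∈ openConn c a) ∧ (A.filter fun y => ∃ a ∈ N, ω ∈ openConn a y).card ≤ j) ∨
            ((¬ ∃ a ∈ N, ω ∈ openConn c a) ∧ (A.filter fun y => ω ∈ openConn c y).card ≤ j)} + δ := by
  intro h
  have key := h 5 (wOfList wit) Finset.univ {1, 2} 0 2 (1 / 16) (by norm_num) (by decide)
  rw [real_blk, real_csm, real_joint, real_small, arith.1, arith.2.1, arith.2.2.1, arith.2.2.2] at key
  norm_num at key

end Summit.CriticalPhenomena.PercolationContinuityZ3.Theorems
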